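/-
Copyright (c) 2026 the pub-hodgecm-mathlib formalisation cell (harness21).  Prover seat hodgecm-mathlib-LH5-p04 (g6), line LH5 (closer stub
`stub_S1finTFCovol`), (R3′) obligation O-RI «right-invariance of the factors of a right-invariant product measure» (critic LHref-S (g6) BOX #8∕#9 (r3)); 2026-09-02.
-/
import Mathlib.MeasureTheory.Group.Measure
import HarnessLib

/-!
# A product measure is right-invariant only if its factors are: `μ₁ ⊗ μ₂` right-invariant, `0 < μ₂ B < ∞` for one measurable `B` ⇒ `μ₁` right-invariant
(Folland, *A Course in Abstract Harmonic Analysis* (1995), §2.2 (Haar measure: invariance is tested on measurable rectangles); the converse of Mathlib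
`MeasureTheory.Measure.prod.instIsMulRightInvariant`)

Topic `MeasureTheory/Group`; namespace `Literature.MeasureTheory.Group`.  THEOREMS ONLY (no definition, no instance, no named fact, no `sorry`).  Cell `pub/hodgecm-mathlib`,
crux H413, line LH5: the (R3′) «block reading + product transport» step of the Z1♭ ⟸ Z1♭♭ junction (★ `TamagawaBlockModelCovolOfSingleBlocks`) transports Z1♭'s right-invariant
`tA₀` along `e₃ : U(Ha)(𝔸) × U(Hb)(𝔸) ≃ₜ* Z(γ₀)` to a right-invariant PRODUCT `μa ⊗ μb`; the single-block letters Z1♭♭ ask for `μa`, `μb` right-invariant SEPARATELY — this file is that step.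

* `preimage_mul_right_prod_mk` — `(· * (g, h)) ⁻¹' (A ×ˢ B) = ((· * g) ⁻¹' A) ×ˢ ((· * h) ⁻¹' B)`.
* **`isMulRightInvariant_of_prod_fst`**: `[(μ₁.prod μ₂).IsMulRightInvariant]`, `MeasurableSet B`, `μ₂ B ≠ 0`, `μ₂ B ≠ ⊤` ⇒ `μ₁.IsMulRightInvariant` (evaluate the product on
  `((· * g) ⁻¹' A) ×ˢ B = (· * (g, 1)) ⁻¹' (A ×ˢ B)`, `Measure.prod_prod` twice, cancel `μ₂ B`); twin **`isMulRightInvariant_of_prod_snd`**.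
HONEST LABEL: count-neutral generic measure theory; HC_CM is proved only modulo the printed citations until rung 0 closes.

## References
* G. B. Folland, *A Course in Abstract Harmonic Analysis*, CRC Press (1995), §2.2 (Haar measure), §2.6 Thm. 2.49 (product groups). [Folland1995]
-/

set_option autoImplicit false

noncomputable section

open MeasureTheory MeasureTheory.Measure Set

namespace Literature.MeasureTheory.Group

variable {G₁ G₂ : Type*} [Group G₁] [Group G₂] [MeasurableSpace G₁] [MeasurableSpace G₂]

omit [MeasurableSpace G₁] [MeasurableSpace G₂] in
/-- Right translation by `(g, h)` on `G₁ × G₂` pulls a rectangle back to the rectangle of the pulled-back sides. [cite: Folland1995, §2.6 Thm. 2.49] -/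
theorem preimage_mul_right_prod_mk (g : G₁) (h : G₂) (A : Set G₁) (B : Set G₂) :
    (fun p : G₁ × G₂ => p * (g, h)) ⁻¹' (A ×ˢ B) = ((fun x : G₁ => x * g) ⁻¹' A) ×ˢ ((fun y : G₂ => y * h) ⁻¹' B) := by
  ext p
  simp only [Set.mem_preimage, Set.mem_prod, Prod.fst_mul, Prod.snd_mul]

/-- **A right-invariant product measure has a right-invariant FIRST factor** as soon as the second factor gives some measurable set finite positive mass
(the converse of Mathlib `Measure.prod.instIsMulRightInvariant`): for measurable `A ⊆ G₁`,
`μ₁((·g)⁻¹A) · μ₂(B) = (μ₁ ⊗ μ₂)((·(g,1))⁻¹(A × B)) = (μ₁ ⊗ μ₂)(A × B) = μ₁(A) · μ₂(B)`, and `μ₂(B) ∈ (0, ∞)` cancels. [cite: Folland1995, §2.2; §2.6 Thm. 2.49] -/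
theorem isMulRightInvariant_of_prod_fst [MeasurableMul G₁] [MeasurableMul G₂] (μ₁ : Measure G₁) (μ₂ : Measure G₂) [SFinite μ₁] [SFinite μ₂]
    [(μ₁.prod μ₂).IsMulRightInvariant] {B : Set G₂} (hB : MeasurableSet B) (h0 : μ₂ B ≠ 0) (hT : μ₂ B ≠ ⊤) :
    μ₁.IsMulRightInvariant := by
  refine ⟨fun g => Measure.ext fun A hA => ?_⟩
  rw [Measure.map_apply (measurable_mul_const g) hA]
  have hmeas : Measurable (fun p : G₁ × G₂ => p * (g, (1 : G₂))) := (measurable_mul_const g).prodMap (measurable_mul_const (1 : G₂))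
  have hprod : (μ₁.prod μ₂) ((fun p : G₁ × G₂ => p * (g, (1 : G₂))) ⁻¹' (A ×ˢ B)) = (μ₁.prod μ₂) (A ×ˢ B) := by
    rw [← Measure.map_apply hmeas (hA.prod hB), map_mul_right_eq_self]
  rw [preimage_mul_right_prod_mk, Measure.prod_prod, Measure.prod_prod] at hprod
  have h1 : (fun y : G₂ => y * 1) ⁻¹' B = B := by
    ext y; simp only [Set.mem_preimage, mul_one]
  rw [h1] at hprod
  exact (ENNReal.mul_left_inj h0 hT).1 hprod

/-- **A right-invariant product measure has a right-invariant SECOND factor** as soon as the first factor gives some measurable set finite positive mass.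
[cite: Folland1995, §2.2; §2.6 Thm. 2.49] -/
theorem isMulRightInvariant_of_prod_snd [MeasurableMul G₁] [MeasurableMul G₂] (μ₁ : Measure G₁) (μ₂ : Measure G₂) [SFinite μ₁] [SFinite μ₂]
    [(μ₁.prod μ₂).IsMulRightInvariant] {A : Set G₁} (hA : MeasurableSet A) (h0 : μ₁ A ≠ 0) (hT : μ₁ A ≠ ⊤) :
    μ₂.IsMulRightInvariant := by
  refine ⟨fun h => Measure.ext fun B hB => ?_⟩
  rw [Measure.map_apply (measurable_mul_const h) hB]
  have hmeas : Measurable (fun p : G₁ × G₂ => p * ((1 : G₁), h)) := (measurable_mul_const (1 : G₁)).prodMap (measurable_mul_const h)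
  have hprod : (μ₁.prod μ₂) ((fun p : G₁ × G₂ => p * ((1 : G₁), h)) ⁻¹' (A ×ˢ B)) = (μ₁.prod μ₂) (A ×ˢ B) := by
    rw [← Measure.map_apply hmeas (hA.prod hB), map_mul_right_eq_self]
  rw [preimage_mul_right_prod_mk, Measure.prod_prod, Measure.prod_prod] at hprod
  have h1 : (fun x : G₁ => x * 1) ⁻¹' A = A := by
    ext x; simp only [Set.mem_preimage, mul_one]
  rw [h1] at hprod
  exact (ENNReal.mul_right_inj h0 hT).1 hprod

end Literature.MeasureTheory.Group

end
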